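import Literature.NumberTheory.LFunctions.ZetaLowHeightZeros
import HarnessLib

/-!
# Kernel-checked certificate: `ζ' ≠ 0` on `(0, ½) × (11/2, 8]`

Trunk T-ANT (NumberTheory/LFunctions). One of the seven certificate files of the certified
low-height computation behind `Literature.NumberTheory.LFunctions.speiser_iff` (Levinson–Montgomery's Theorem 1 (1.2) needs
`ζ ≠ 0` on `(0,½) × (0, 10.5]` and `ζ' ≠ 0` on `(0,½) × (0, 10]`; classically Gram 1903 and
Spira 1965). The literal `Literature.NumberTheory.LFunctions.ZetaLowHeightZeros.ZetaNum.certDZeta5hto8` lists, for the four edges of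
`[0, ½] × [11/2, 8]`, pieces with quadrant labels (scaled integers at `2^48`); it was produced by
an external planner that mirrors the checker bit for bit, but its validity rests only on the
kernel evaluation `Literature.RH.ZetaNum.certDZeta5hto8_ok : certCheck 1 certDZeta5hto8 = true`
(`decide +kernel`, Euler–Maclaurin `N = 6` enclosures in fixed-point interval arithmetic and the
winding-number certificate theorem; see `ZetaLowHeightZeros.lean`). No axioms beyond
`propext`, `Classical.choice`, `Quot.sound`.

## Main results

* `Literature.NumberTheory.LFunctions.ZetaLowHeightZeros.ZetaNum.certDZeta5hto8_ok` — the kernel check.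
* `Literature.NumberTheory.LFunctions.ZetaLowHeightZeros.ZetaNum.deriv_riemannZeta_ne_zero_DZeta5hto8` — `ζ'(s) ≠ 0` for `0 < Re s < ½`, `11/2 < Im s ≤ 8`.
-/

namespace Literature.NumberTheory.LFunctions.ZetaLowHeightZeros.ZetaNum

/-- The certificate data for `ζ'` on `[0, ½] × [11/2, 8]` (bottom, right, top, left edges).
[folklore] -/
def certDZeta5hto8 : ZetaNum.Cert :=
  ⟨1548112371908608, 2251799813685248, 47681653178368, 0, [(100727720509440, 3), (140737488355328, 3)],
  1587018333159424, 3, [(1626810131415040, 3), (1667555412410368, 3), (1709310010720256, 3), (1752001985642496, 3), (1795596977438720, 3), (1840142230749184, 3), (1885672105312256, 3), (1932204854738944, 3), (1979727594127360, 3), (2028189857611776, 3), (2077447763787776, 3), (2126916123361280, 3), (2176445686218752, 3), (2225876464828416, 3), (2251799813685248, 3)],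
  76021994881024, 3, [(140737488355328, 3)],
  1576802753445888, 3, [(1606017120993280, 3), (1635799497965568, 3), (1666193907777536, 3), (1697237931393024, 3), (1728959486099456, 3), (1761254418939904, 3), (1794163532103680, 3), (1827726554038272, 3), (1861981065707520, 3), (1896960353107968, 3), (1932691259785216, 3), (1969190965608448, 3), (2006461618061312, 3), (2044489258500096, 3), (2082930289541120, 3), (2121708475514880, 3), (2160803415326720, 3), (2200181822980096, 3), (2239794306351104, 3), (2251799813685248, 3)]⟩

/-- **The kernel check of the certificate.** [folklore] -/
theorem certDZeta5hto8_ok : ZetaNum.certCheck 1 certDZeta5hto8 = true := by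
  decide +kernel

/-- **`ζ'(s) ≠ 0` for `0 < Re s < ½`, `11/2 < Im s ≤ 8`** (certified computation).
[folklore] -/
theorem deriv_riemannZeta_ne_zero_DZeta5hto8 {s : ℂ} (h0 : 0 < s.re) (h1 : s.re < 1 / 2)
    (h2 : (11 / 2 : ℝ) < s.im) (h3 : s.im ≤ 8) : deriv riemannZeta s ≠ 0 :=
  ZetaNum.deriv_riemannZeta_ne_zero_of_certCheck certDZeta5hto8_ok h0 h1
    (by norm_num [certDZeta5hto8, Literature.Analysis.ValidatedNumerics.Numerics.SC]; exact h2)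
    (by norm_num [certDZeta5hto8, Literature.Analysis.ValidatedNumerics.Numerics.SC]; exact h3)

end Literature.NumberTheory.LFunctions.ZetaLowHeightZeros.ZetaNum
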